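import Mathlib
import Summits.NavierStokesRegularity.NavierStokesRegularity.Theorems.EulerZoomLiouvillePowerGaugeEulerLiouvilleSelfSimilarPastPiercingSpheres
import Literature.Analysis.FluidPDE.SelfSimilarEulerOutgoingExclusionTools
import HarnessLib.Audit

/-!
# Crux `EulerZoomLiouville.PowerGaugeEulerLiouville` (stmt-NavierStokesRegularity-19832), THE ONE STATEMENT `stub_selfSimilarC2Needle`:
# THE NEEDLE MUST BE BERNOULLI-HIGH — a vortical fast-inflow channel whose Bernoulli values sink below every level is impossible

Route №10 `EulerZoomLiouville` (NavierStokesRegularity), crux E = stmt-NavierStokesRegularity-19832, registered residue `stub_selfSimilarC2Needle`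
(THE ONE STATEMENT; skeleton v47 of the LEAD ns-typeII-p2 g11).  Sequel of `…SelfSimilarPiercingSpheres` (p613616): there the needle of an exactly
self-similar in-class `C²` profile `U` (exponent `0 < γ = 1/(2+ρ) < ½`, transport field `W = γy + U`) was shown to be VORTICAL through every large
sphere.  Here the first DYNAMICAL lever on the needle is recorded — it uses the profile EQUATION, through Constantin–Ignatova–Vicol's self-similar
Bernoulli function `ℋ = ½|W|² + P + ½γ(γ−1)|y|²` (CIV (3.30)), which is a LYAPUNOV FUNCTION of the self-similar Lagrangian flow in the window:
`W·∇ℋ = (2γ−1)|W|² ≤ 0` (CIV (3.31), tree `IsSelfSimilarEulerProfile.fderiv_selfSimilarBernoulli_transport`).  Consequently `ℋ` is NON-DECREASING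
along BACKWARD similarity orbits, and the first-exit argument of `Loc.curl_eq_zero_of_piercingIrrotational` gains a second exit test:

> (`Loc.curl_eq_zero_of_piercingBernoulli`) if for every level `h` there are radii `R` beyond every bound such that every FAST-INFLOW point `y` of
> the sphere `‖y‖ = R` (`⟪y, U y⟫ ≤ −γ‖y‖²`, i.e. `⟪y, W y⟫ ≤ 0`) is EITHER irrotational, `curl U y = 0`, OR Bernoulli-low, `ℋ(y) < h`, then
> `curl U ≡ 0`.

Indeed a vortical point `x` near `x₀` has `ℋ(x) ≥ h₀ := min_{B̄(x₀,1)} ℋ`; take such a sphere for the level `h₀` beyond `‖x₀‖ + 1`; the backward orbit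
of `x` is either confined (null set, `volume_vortical_confined_eq_zero`) or exits first at a fast-inflow point `y₁` (one-sided Fermat), where EITHER
`curl U y₁ = 0` — transported back to `x` by the linear Cauchy equation, contradiction — OR `ℋ(y₁) < h₀ ≤ ℋ(x)` — contradicting the monotonicity of
`ℋ` along the orbit.  WHAT IT BUYS (the v48 binder of THE ONE STATEMENT): at a fast-inflow point `y`, `‖y‖ = R`, with radial rate
`s = −⟪y, U y⟫/R² ≥ γ` and tangential part `T`, `ℋ(y) = P(y) + ½R²[(s−γ)² − γ(1−γ)] + ½|T|²`; so the surviving needles are, through EVERY large sphere,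
vortical AND Bernoulli-high: SUPER-BALLISTIC (`(s−γ)² + |T|²/R² ≥ γ(1−γ) − O(R⁻²)`, threshold rate `s* = γ + √(γ(1−γ)) ∈ [0.889…, 1)`) or PRESSURISED
(`P(y) ≳ R²`) at some fast-inflow vortical point — the unpressurised sub-ballistic channels of RESIDUE-MEMO-19832-g10 §5.3 (there a heuristic for
straight cores) are EXCLUDED with no geometric hypothesis.  The member-level forms quantify over ALL classical pressures `P'` of the `C²` velocity
profile (they differ by constants, so the condition is pressure-free in content; this avoids speaking of sphere values of the class's a.e.-defined
pressure profile): `Loc.selfSimilar_ae_eq_zero_of_piercingBernoulliC2_profile` (whole slab) and `Past.selfSimilar_ae_eq_zero_of_piercingBernoulliC2_profile_past`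
(past-exact about any `(T, x₀)`), plus the reduction `Loc.piercingBernoulli_of_piercingIrrotational` (v47's binder implies the new one).

WHAT THIS IS NOT: not NS, not E — a widening of the tame side of THE ONE STATEMENT; Bernoulli-high vortical needles, the weak class and the
non-self-similar members remain; 19832 is OPEN. [folklore; ConstantinIgnatovaVicol2026Putative §3.4.3 (3.30)–(3.33) (the Lyapunov identity), §3.5 (setting)]
-/

noncomputable section

set_option linter.dupNamespace false

open MeasureTheory Set Filter Topology Metric Function InnerProductSpace
open scoped RealInnerProductSpace NNReal ENNReal ContDiff

namespace Summit.NavierStokesRegularity.NavierStokesRegularity.Theorems.PowerGaugeEulerLiouville.Loc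

open Literature.Analysis Literature.Analysis.FluidPDE
open Summit.NavierStokesRegularity.NavierStokesRegularity.Theorems.PowerGaugeEulerLiouville.Kelvin
open Summit.NavierStokesRegularity.NavierStokesRegularity.Theorems.PowerGaugeEulerLiouville.NodalFiniteness

variable {γ : ℝ} {U : EuclideanSpace ℝ (Fin 3) → EuclideanSpace ℝ (Fin 3)} {P : EuclideanSpace ℝ (Fin 3) → ℝ}

/-- **The Bernoulli function is non-decreasing along backward similarity orbits.**  `(U, P)` a `C²` profile of CIV (3.3) with `γ ≤ ½`;
`Y` a curve with `Y′(t) = −W(Y(t))` (`W = γy + U`) on `[0, t₁]`.  Then `ℋ(Y 0) ≤ ℋ(Y t₁)` — from `W·∇ℋ = (2γ−1)|W|² ≤ 0` (CIV (3.31)).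
[cite: ConstantinIgnatovaVicol2026Putative, §3.4.3 eq. (3.31)–(3.33)] -/
theorem selfSimilarBernoulli_monotone_backward (hprof : IsSelfSimilarEulerProfile γ 0 U P) (hγ2 : γ ≤ 1 / 2)
    {Y : ℝ → EuclideanSpace ℝ (Fin 3)} {t₁ : ℝ} (ht₁ : 0 ≤ t₁)
    (hY : ∀ t ∈ Icc 0 t₁, HasDerivAt Y ((-1 : ℝ) • selfSimilarTransport γ 0 U (Y t)) t) :
    selfSimilarBernoulli γ 0 U P (Y 0) ≤ selfSimilarBernoulli γ 0 U P (Y t₁) := by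
  set Hb : EuclideanSpace ℝ (Fin 3) → ℝ := selfSimilarBernoulli γ 0 U P with hHb
  have hH1 : ContDiff ℝ 1 Hb := hprof.contDiff_selfSimilarBernoulli
  have hHd : Differentiable ℝ Hb := hH1.differentiable (by norm_num)
  -- derivative of `ℋ ∘ Y`
  have hder : ∀ t ∈ Icc 0 t₁, HasDerivAt (fun s => Hb (Y s))
      ((1 - 2 * γ) * ‖selfSimilarTransport γ 0 U (Y t)‖ ^ 2) t := by
    intro t ht
    have h1 := (hHd (Y t)).hasFDerivAt.comp_hasDerivAt t (hY t ht)
    have h2 : fderiv ℝ Hb (Y t) ((-1 : ℝ) • selfSimilarTransport γ 0 U (Y t)) =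
        (1 - 2 * γ) * ‖selfSimilarTransport γ 0 U (Y t)‖ ^ 2 := by
      rw [ContinuousLinearMap.map_smul, hprof.fderiv_selfSimilarBernoulli_transport (Y t), smul_eq_mul]
      ring
    rw [h2] at h1
    exact h1
  have hcont : ContinuousOn (fun s => Hb (Y s)) (Icc 0 t₁) :=
    fun t ht => (hder t ht).continuousAt.continuousWithinAt
  have hmono : MonotoneOn (fun s => Hb (Y s)) (Icc 0 t₁) := by
    refine monotoneOn_of_hasDerivWithinAt_nonneg (convex_Icc 0 t₁) hcont
      (fun t ht => (hder t (interior_subset ht)).hasDerivWithinAt) ?_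
    intro t _
    have hγ' : 0 ≤ 1 - 2 * γ := by linarith
    positivity
  exact hmono ⟨le_rfl, ht₁⟩ ⟨ht₁, le_rfl⟩ ht₁

/-- **THE NEEDLE MUST BE BERNOULLI-HIGH THROUGH EVERY LARGE SPHERE.**  `(U, P)` a `C²` profile of CIV (3.3) with `0 < γ < ½` and Bernoulli
function `ℋ = selfSimilarBernoulli γ 0 U P`; suppose that for every level `h` there are radii `R` beyond every bound such that on the sphere
`‖y‖ = R` every fast-inflow point is irrotational or Bernoulli-low: `⟪y, U y⟫ ≤ −γ‖y‖² ⇒ (curl U y = 0 ∨ ℋ y < h)`.  Then `curl U ≡ 0`.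
(First exit of backward similarity orbits through fast-inflow points + transport of vanishing vorticity, as in
`curl_eq_zero_of_piercingIrrotational`, + monotonicity of `ℋ` along backward orbits.) [folklore] -/
theorem curl_eq_zero_of_piercingBernoulli (hprof : IsSelfSimilarEulerProfile γ 0 U P) (hγ : 0 < γ) (hγ2 : γ < 1 / 2)
    (hS : ∀ h R₀ : ℝ, ∃ R : ℝ, R₀ ≤ R ∧ ∀ y : EuclideanSpace ℝ (Fin 3), ‖y‖ = R →
      ⟪y, U y⟫ ≤ -(γ * ‖y‖ ^ 2) → (curl U y = 0 ∨ selfSimilarBernoulli γ 0 U P y < h))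
    (x₀ : EuclideanSpace ℝ (Fin 3)) : curl U x₀ = 0 := by
  -- adapted from `curl_eq_zero_of_piercingIrrotational` (…SelfSimilarPiercingSpheres, p613616)
  have hU2 : ContDiff ℝ 2 U := hprof.contDiff_velocity
  have hU1 : ContDiff ℝ 1 U := hU2.of_le (by norm_num)
  set Hb : EuclideanSpace ℝ (Fin 3) → ℝ := selfSimilarBernoulli γ 0 U P with hHb
  have hHc : Continuous Hb := hprof.contDiff_selfSimilarBernoulli.continuous
  -- the Bernoulli floor `h₀` on the closed unit ball about `x₀`
  obtain ⟨z₀, -, hz₀⟩ := (isCompact_closedBall x₀ (1 : ℝ)).exists_isMinOn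
    ⟨x₀, mem_closedBall_self zero_le_one⟩ hHc.continuousOn
  set h₀ : ℝ := Hb z₀ with hh₀
  have hfloor : ∀ x : EuclideanSpace ℝ (Fin 3), dist x x₀ < 1 → h₀ ≤ Hb x :=
    fun x hx => hz₀ (mem_closedBall.2 hx.le)
  obtain ⟨R, hR₀, hSR⟩ := hS h₀ (max (‖x₀‖ + 1) 1)
  have hR1 : 1 ≤ R := (le_max_right _ _).trans hR₀
  have hRx : ‖x₀‖ + 1 ≤ R := (le_max_left _ _).trans hR₀
  have hR : 0 < R := by linarith
  -- the cutoff field, `= U` on `ball 0 (R + 1)`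
  obtain ⟨V, hV, ⟨M, hVM⟩, -, ⟨K, hK⟩, hagree⟩ := exists_cutoff_local_smul hU2 (R := R + 1) (by linarith)
  have hV1 : ContDiff ℝ 1 V := hV.of_le (by norm_num)
  have hnear : ∀ z : EuclideanSpace ℝ (Fin 3), ‖z‖ ≤ R → V =ᶠ[𝓝 z] U := by
    intro z hz
    have hmem : ball (0 : EuclideanSpace ℝ (Fin 3)) (R + 1) ∈ 𝓝 z :=
      isOpen_ball.mem_nhds (by rw [mem_ball, dist_zero_right]; linarith)
    exact Filter.eventually_of_mem hmem fun y hy => hagree y hy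
  have hDeq : ∀ z : EuclideanSpace ℝ (Fin 3), ‖z‖ ≤ R → fderiv ℝ V z = fderiv ℝ U z :=
    fun z hz => (hnear z hz).fderiv_eq
  have hWeq : ∀ z : EuclideanSpace ℝ (Fin 3), ‖z‖ ≤ R →
      selfSimilarTransport γ 0 V z = selfSimilarTransport γ 0 U z := by
    intro z hz
    simp only [selfSimilarTransport_apply, hagree z (by rw [mem_ball, dist_zero_right]; linarith)]
  set Φ := ODE.evolutionMap (fun _ : ℝ => selfSimilarTransport γ 0 V) 0 with hΦ
  -- every vortical point near `x₀` has a confined backward `U`-half-orbit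
  have hsubset : {x : EuclideanSpace ℝ (Fin 3) | dist x x₀ < 1 ∧ curl U x ≠ 0} ⊆
      {x : EuclideanSpace ℝ (Fin 3) | curl U x ≠ 0 ∧
        ∃ Y : ℝ → EuclideanSpace ℝ (Fin 3), Y 0 = x ∧
          (∀ t, 0 ≤ t → HasDerivAt Y ((-1 : ℝ) • selfSimilarTransport γ 0 U (Y t)) t) ∧
          ∀ t, 0 ≤ t → ‖Y t‖ ≤ R} := by
    rintro x ⟨hx, hcx⟩
    have hxR : ‖x‖ < R := by
      have := norm_le_norm_add_norm_sub' x x₀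
      rw [← dist_eq_norm] at this
      linarith
    set Yp : ℝ → EuclideanSpace ℝ (Fin 3) := fun t => Φ (-t) x with hYp
    have hYpV : ∀ t, HasDerivAt Yp ((-1 : ℝ) • selfSimilarTransport γ 0 V (Yp t)) t :=
      fun t => C2.Kelvin.hasDerivAt_flow_neg (γ := γ) hV1 hK x t
    have hYpc : Continuous Yp := continuous_iff_continuousAt.2 fun t => (hYpV t).continuousAt
    have hYp0 : Yp 0 = x := by simp [hYp, hΦ, ODE.evolutionMap_self]
    have hYpU : ∀ t, ‖Yp t‖ ≤ R → HasDerivAt Yp ((-1 : ℝ) • selfSimilarTransport γ 0 U (Yp t)) t := by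
      intro t ht
      have h := hYpV t
      rwa [hWeq (Yp t) ht] at h
    by_cases hconf : ∀ t, 0 ≤ t → ‖Yp t‖ ≤ R
    · exact ⟨hcx, Yp, hYp0, fun t ht => hYpU t (hconf t ht), hconf⟩
    -- otherwise: FIRST EXIT through the sphere `‖y‖ = R`
    exfalso
    push Not at hconf
    obtain ⟨t₂, ht₂0, ht₂R⟩ := hconf
    set T : Set ℝ := {t | 0 ≤ t ∧ R ≤ ‖Yp t‖} with hT
    have hTne : T.Nonempty := ⟨t₂, ht₂0, ht₂R.le⟩
    have hTcl : IsClosed T := by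
      rw [hT, setOf_and]
      exact (isClosed_le continuous_const continuous_id).inter (isClosed_le continuous_const hYpc.norm)
    have hTbdd : BddBelow T := ⟨0, fun t ht => ht.1⟩
    set t₁ : ℝ := sInf T with ht₁
    have ht₁T : t₁ ∈ T := hTcl.csInf_mem hTne hTbdd
    have ht₁0 : 0 ≤ t₁ := ht₁T.1
    have hbefore : ∀ t, 0 ≤ t → t < t₁ → ‖Yp t‖ < R := by
      intro t ht0 htlt
      by_contra hge
      push Not at hge
      have : t₁ ≤ t := csInf_le hTbdd ⟨ht0, hge⟩
      linarith
    have ht₁pos : 0 < t₁ := by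
      rcases ht₁0.lt_or_eq with h | h
      · exact h
      · exfalso
        have := ht₁T.2
        rw [← h, hYp0] at this
        linarith
    -- `‖Yp t₁‖ = R` (continuity from the left)
    have hnorm₁ : ‖Yp t₁‖ = R := by
      refine le_antisymm ?_ ht₁T.2
      by_contra hgt
      push Not at hgt
      have hev : ∀ᶠ t in 𝓝 t₁, R < ‖Yp t‖ :=
        (hYpc.norm.continuousAt (x := t₁)).eventually (lt_mem_nhds hgt)
      obtain ⟨δ, hδ, hball⟩ := Metric.eventually_nhds_iff.1 hev
      set t : ℝ := max (t₁ - δ / 2) 0 with htdef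
      have ht0 : 0 ≤ t := le_max_right _ _
      have htlt : t < t₁ := by
        rw [htdef]; exact max_lt (by linarith) ht₁pos
      have hdist : dist t t₁ < δ := by
        rw [dist_comm, Real.dist_eq, abs_of_nonneg (by linarith)]
        have : t₁ - δ / 2 ≤ t := le_max_left _ _
        linarith
      have h1 := hball hdist
      have h2 := hbefore t ht0 htlt
      linarith
    have hin : ∀ t ∈ Icc 0 t₁, ‖Yp t‖ ≤ R := by
      intro t ht
      rcases ht.2.lt_or_eq with h | h
      · exact (hbefore t ht.1 h).le
      · rw [h, hnorm₁]
    -- Fermat at the one-sided maximum of `g = ‖Yp‖²` on `[0, t₁]`: `g′(t₁) ≥ 0`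
    set g : ℝ → ℝ := fun t => ‖Yp t‖ ^ 2 with hg
    have hg' : HasDerivAt g (2 * ⟪Yp t₁, (-1 : ℝ) • selfSimilarTransport γ 0 V (Yp t₁)⟫) t₁ := (hYpV t₁).norm_sq
    have hmax : IsLocalMaxOn g (Icc 0 t₁) t₁ := by
      refine Filter.eventually_of_mem self_mem_nhdsWithin fun t ht => ?_
      show ‖Yp t‖ ^ 2 ≤ ‖Yp t₁‖ ^ 2
      rw [hnorm₁]
      exact pow_le_pow_left₀ (norm_nonneg _) (hin t ht) 2
    have hcone : -t₁ ∈ posTangentConeAt (Icc (0 : ℝ) t₁) t₁ := by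
      refine mem_posTangentConeAt_of_segment_subset ?_
      rw [show t₁ + -t₁ = (0 : ℝ) by ring, segment_symm, segment_eq_Icc ht₁0]
    have hfermat := hmax.hasFDerivWithinAt_nonpos hg'.hasFDerivAt.hasFDerivWithinAt hcone
    -- so `⟪Y, W(Y)⟫ ≤ 0` at the exit point: a fast-inflow point of the sphere
    have hWY : ⟪Yp t₁, selfSimilarTransport γ 0 U (Yp t₁)⟫ ≤ 0 := by
      rw [← hWeq (Yp t₁) hnorm₁.le]
      have h1 : (-t₁) • (2 * ⟪Yp t₁, (-1 : ℝ) • selfSimilarTransport γ 0 V (Yp t₁)⟫) ≤ 0 := by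
        simpa using hfermat
      rw [inner_smul_right, smul_eq_mul] at h1
      nlinarith
    have hfast : ⟪Yp t₁, U (Yp t₁)⟫ ≤ -(γ * ‖Yp t₁‖ ^ 2) := by
      rw [selfSimilarTransport_apply, sub_zero, inner_add_right, inner_smul_right, real_inner_self_eq_norm_sq] at hWY
      linarith
    -- the exit point is irrotational: directly, or because a Bernoulli-low exit contradicts the monotonicity of `ℋ`
    have hcurl₁ : curl U (Yp t₁) = 0 := by
      rcases hSR (Yp t₁) hnorm₁ hfast with h | hlow
      · exact h
      · exfalso
        have hmono := selfSimilarBernoulli_monotone_backward hprof hγ2.le ht₁0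
          (fun t ht => hYpU t (hin t ht))
        have hx0 : h₀ ≤ Hb (Yp 0) := by rw [hYp0]; exact hfloor x hx
        have : Hb (Yp t₁) < h₀ := hlow
        linarith
    -- transport the zero back to `x` along the `U`-orbit: linear Cauchy equation + uniqueness
    set A : ℝ → EuclideanSpace ℝ (Fin 3) →L[ℝ] EuclideanSpace ℝ (Fin 3) :=
      fun t => (-1 : ℝ) • fderiv ℝ (selfSimilarTransport γ 0 U) (Yp t) with hA
    set u : ℝ → EuclideanSpace ℝ (Fin 3) := fun s => Real.exp ((-1 : ℝ) * (1 + γ) * s) • curl U (Yp s) with hu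
    have hu' : ∀ t ∈ Icc 0 t₁, HasDerivAt u (A t (u t)) t := fun t ht =>
      hasDerivAt_weightedCurl_comp hprof (hYpU t (hin t ht))
    have hKV : ∀ t ∈ Icc 0 t₁, LipschitzOnWith (Real.toNNReal (|γ| + K))
        (fun w : EuclideanSpace ℝ (Fin 3) => A t w) univ := by
      intro t ht
      refine ((A t).lipschitz.weaken ?_).lipschitzOnWith
      have hK0 : 0 ≤ K := (norm_nonneg _).trans (hK 0)
      rw [← NNReal.coe_le_coe, coe_nnnorm, Real.coe_toNNReal _ (add_nonneg (abs_nonneg γ) hK0)]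
      calc ‖A t‖ = ‖fderiv ℝ (selfSimilarTransport γ 0 U) (Yp t)‖ := by
            show ‖(-1 : ℝ) • fderiv ℝ (selfSimilarTransport γ 0 U) (Yp t)‖ = _
            rw [norm_smul, norm_neg, norm_one, one_mul]
        _ ≤ |γ| + K := by
            rw [fderiv_transport_eq hprof (Yp t)]
            refine (norm_add_le _ _).trans (add_le_add ?_ ?_)
            · rw [norm_smul, Real.norm_eq_abs]
              exact mul_le_of_le_one_right (abs_nonneg γ) ContinuousLinearMap.norm_id_le
            · rw [← hDeq (Yp t) (hin t ht)]; exact hK _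
    have hcont : ContinuousOn u (Icc 0 t₁) := fun t ht => (hu' t ht).continuousAt.continuousWithinAt
    have hut₁ : u t₁ = 0 := by simp [hu, hcurl₁]
    have hEq : EqOn u (fun _ => (0 : EuclideanSpace ℝ (Fin 3))) (Icc 0 t₁) :=
      ODE_solution_unique_of_mem_Icc_left (v := fun t w => A t w) (s := fun _ => univ)
        (fun t ht => hKV t (Ioc_subset_Icc_self ht)) hcont
        (fun t ht => (hu' t (Ioc_subset_Icc_self ht)).hasDerivWithinAt) (fun _ _ => mem_univ _)
        continuousOn_const
        (fun t _ => by
          have h0 : HasDerivWithinAt (fun _ : ℝ => (0 : EuclideanSpace ℝ (Fin 3))) 0 (Iic t) t :=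
            hasDerivWithinAt_const _ _ _
          simpa using h0)
        (fun _ _ => mem_univ _) (by simpa using hut₁)
    have hu0 : u 0 = 0 := hEq ⟨le_rfl, ht₁0⟩
    have : curl U x = 0 := by simpa [hu, hYp0] using hu0
    exact hcx this
  have hnull := volume_vortical_confined_eq_zero hprof hγ hγ2 hR
  have hopen : IsOpen {x : EuclideanSpace ℝ (Fin 3) | dist x x₀ < 1 ∧ curl U x ≠ 0} := by
    have h1 : IsOpen {x : EuclideanSpace ℝ (Fin 3) | dist x x₀ < 1} := isOpen_lt (continuous_id.dist continuous_const) continuous_const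
    exact h1.inter (isOpen_ne_fun (differentiable_curl_of_contDiff hU2).continuous continuous_const)
  have hzero : volume {x : EuclideanSpace ℝ (Fin 3) | dist x x₀ < 1 ∧ curl U x ≠ 0} = 0 := measure_mono_null hsubset hnull
  have hempty := (hopen.measure_eq_zero_iff volume).1 hzero
  by_contra hx₀
  have : x₀ ∈ ({x : EuclideanSpace ℝ (Fin 3) | dist x x₀ < 1 ∧ curl U x ≠ 0} : Set _) := ⟨by simp, hx₀⟩
  rw [hempty] at this
  exact this

/-- **Reduction: v47's irrotational piercing implies Bernoulli piercing** (the first disjunct, for every level and every pressure). [folklore] -/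
theorem piercingBernoulli_of_piercingIrrotational
    (hS : ∀ R₀ : ℝ, ∃ R : ℝ, R₀ ≤ R ∧ ∀ y : EuclideanSpace ℝ (Fin 3), ‖y‖ = R →
      ⟪y, U y⟫ ≤ -(γ * ‖y‖ ^ 2) → curl U y = 0) (P' : EuclideanSpace ℝ (Fin 3) → ℝ) (h R₀ : ℝ) :
    ∃ R : ℝ, R₀ ≤ R ∧ ∀ y : EuclideanSpace ℝ (Fin 3), ‖y‖ = R →
      ⟪y, U y⟫ ≤ -(γ * ‖y‖ ^ 2) → (curl U y = 0 ∨ selfSimilarBernoulli γ 0 U P' y < h) := by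
  obtain ⟨R, hR, hSR⟩ := hS R₀
  exact ⟨R, hR, fun y hy hfast => Or.inl (hSR y hy hfast)⟩

/-! ### Member level (whole slab) -/

/-- **MEMBER LEVEL — an exactly self-similar member of Seregin's power-gauged class whose `C²` velocity profile has BERNOULLI PIERCING is trivial.**
Crux hypotheses verbatim (`0 < ρ ≤ ½`) + exact self-similarity + `V ∈ C²` + for EVERY classical pressure `P'` of `V` (a `C¹` function making
`(V, P')` a CIV (3.3) profile — they exist, `WeakToClassical.exists_isSelfSimilarEulerProfile_of_contDiff`, and differ by constants), every level `h`
and every `R₀`, a radius `R ≥ R₀` on whose sphere every fast-inflow point is irrotational or has `ℋ_{P'} < h` ⇒ `u = 0` a.e.  Contains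
`selfSimilar_ae_eq_zero_of_piercingIrrotationalC2_profile` (`piercingBernoulli_of_piercingIrrotational`). [folklore] -/
theorem selfSimilar_ae_eq_zero_of_piercingBernoulliC2_profile {ρ : ℝ} (hρ : 0 < ρ) (hρ1 : ρ ≤ 1 / 2)
    {u : ℝ → EuclideanSpace ℝ (Fin 3) → EuclideanSpace ℝ (Fin 3)} {p : ℝ → EuclideanSpace ℝ (Fin 3) → ℝ}
    {H : ℝ → EuclideanSpace ℝ (Fin 3) → EuclideanSpace ℝ (Fin 3) →L[ℝ] EuclideanSpace ℝ (Fin 3)} {c : ℝ≥0}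
    (hsw : IsSuitableWeakSolutionOn (slab (EuclideanSpace ℝ (Fin 3)) (Iio 0) isOpen_Iio) 0 0 u p)
    (hgauge : ∀ a : ℝ, 0 < a →
      ENNReal.ofReal (a ^ (2 * ρ)) * cknA a (0 : ℝ × EuclideanSpace ℝ (Fin 3)) u +
          ENNReal.ofReal (a ^ ρ) * cknE a (0 : ℝ × EuclideanSpace ℝ (Fin 3)) H +
        ENNReal.ofReal (a ^ (2 * ρ)) * cknD a (0 : ℝ × EuclideanSpace ℝ (Fin 3)) p ≤ (c : ℝ≥0∞))
    {V : EuclideanSpace ℝ (Fin 3) → EuclideanSpace ℝ (Fin 3)} {P : EuclideanSpace ℝ (Fin 3) → ℝ}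
    (hu : ∀ τ : ℝ, τ < 0 → u τ = selfSimilarCollapse (1 / (2 + ρ)) 0 V τ)
    (hp : ∀ τ : ℝ, τ < 0 → p τ = selfSimilarCollapsePressure (1 / (2 + ρ)) 0 P τ)
    (hV : ContDiff ℝ 2 V)
    (hS : ∀ P' : EuclideanSpace ℝ (Fin 3) → ℝ, IsSelfSimilarEulerProfile (1 / (2 + ρ)) 0 V P' →
      ∀ h R₀ : ℝ, ∃ R : ℝ, R₀ ≤ R ∧ ∀ y : EuclideanSpace ℝ (Fin 3), ‖y‖ = R →
        ⟪y, V y⟫ ≤ -(1 / (2 + ρ) * ‖y‖ ^ 2) →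
          (curl V y = 0 ∨ selfSimilarBernoulli (1 / (2 + ρ)) 0 V P' y < h)) :
    uncurry u =ᵐ[volume.restrict (Iio (0 : ℝ) ×ˢ (univ : Set (EuclideanSpace ℝ (Fin 3))))] 0 := by
  -- adapted from `selfSimilar_ae_eq_zero_of_piercingIrrotationalC2_profile` (…SelfSimilarPiercingSpheres)
  have hρ1' : ρ < 1 := by linarith
  have h2ρ : (0 : ℝ) < 2 + ρ := by linarith
  have hγ : (0 : ℝ) < 1 / (2 + ρ) := one_div_pos.2 h2ρ
  have hγ2 : 1 / (2 + ρ) < 1 / 2 := one_div_lt_one_div_of_lt two_pos (by linarith)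
  have hA : ∀ a : ℝ, 0 < a → ENNReal.ofReal (a ^ (2 * ρ)) *
      cknA a (0 : ℝ × EuclideanSpace ℝ (Fin 3)) u ≤ (c : ℝ≥0∞) :=
    fun a ha => le_trans (le_trans le_self_add le_self_add) (hgauge a ha)
  have hD : ∀ a : ℝ, 0 < a → ENNReal.ofReal (a ^ (2 * ρ)) *
      cknD a (0 : ℝ × EuclideanSpace ℝ (Fin 3)) p ≤ (c : ℝ≥0∞) :=
    fun a ha => le_trans le_add_self (hgauge a ha)
  have hpm : AEStronglyMeasurable (uncurry p)
      (volume.restrict (Iio (0 : ℝ) ×ˢ (univ : Set (EuclideanSpace ℝ (Fin 3))))) := by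
    have := hsw.distributional.2.2.1.aestronglyMeasurable
    simpa [slab] using this
  have hPm := aestronglyMeasurable_pressureProfile hpm hp
  have hDprof := profile_pressure_weight_of_gaugeD hρ hρ1' hpm hp hD
  have hP1 : LocallyIntegrable P volume :=
    EnergySaturation.locallyIntegrable_pressure_of_weight hρ1' hPm
      (ENNReal.mul_ne_top ENNReal.ofReal_ne_top ENNReal.coe_ne_top) hDprof
  obtain ⟨P', hprof⟩ := WeakToClassical.exists_isSelfSimilarEulerProfile_of_contDiff hsw.distributional hu hp hV hP1
  have hcurl := curl_eq_zero_of_piercingBernoulli hprof hγ hγ2 (hS P' hprof)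
  exact Loc.selfSimilar_ae_eq_zero_of_irrotationalC2_profile hρ hsw.distributional hA hu hV hcurl

end Summit.NavierStokesRegularity.NavierStokesRegularity.Theorems.PowerGaugeEulerLiouville.Loc

/-! ### Member level (past-exact about any `(T, x₀)`) -/

namespace Summit.NavierStokesRegularity.NavierStokesRegularity.Theorems.PowerGaugeEulerLiouville.Past

open Literature.Analysis Literature.Analysis.FluidPDE

variable {ρ T T₁ : ℝ} {x₀ : EuclideanSpace ℝ (Fin 3)}
  {u : ℝ → EuclideanSpace ℝ (Fin 3) → EuclideanSpace ℝ (Fin 3)} {p : ℝ → EuclideanSpace ℝ (Fin 3) → ℝ}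
  {H : ℝ → EuclideanSpace ℝ (Fin 3) → EuclideanSpace ℝ (Fin 3) →L[ℝ] EuclideanSpace ℝ (Fin 3)} {c : ℝ≥0}
  {V : EuclideanSpace ℝ (Fin 3) → EuclideanSpace ℝ (Fin 3)} {P : EuclideanSpace ℝ (Fin 3) → ℝ}

/-- **Past-exact member, `C²` profile with BERNOULLI PIERCING: the profile is ZERO** (`0 < ρ ≤ ½`; exact self-similarity about `(T, x₀)` for
`τ < T₁ ≤ min 0 T`): the extension from the far past supplies a CIV (3.3) profile (`Past.exists_isSelfSimilarEulerProfile`), the LEAD's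
`Loc.curl_eq_zero_of_piercingBernoulli` gives `curl V ≡ 0`, and `Past.profile_eq_zero_of_irrotationalC2` finishes. [folklore] -/
theorem profile_eq_zero_of_piercingBernoulliC2 (hρ : 0 < ρ) (hρh : ρ ≤ 1 / 2) (hT₁ : T₁ ≤ 0) (hTT₁ : T₁ ≤ T)
    (hsol : IsDistributionalNSSolutionOn (slab (EuclideanSpace ℝ (Fin 3)) (Iio 0) isOpen_Iio) 0 0 u p)
    (hA : ∀ a : ℝ, 0 < a → ENNReal.ofReal (a ^ (2 * ρ)) *
      cknA a (0 : ℝ × EuclideanSpace ℝ (Fin 3)) u ≤ (c : ℝ≥0∞))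
    (hu : ∀ τ : ℝ, τ < T₁ → u τ = fun x => selfSimilarCollapse (1 / (2 + ρ)) T V τ (x - x₀))
    (hp : ∀ τ : ℝ, τ < T₁ → p τ = fun x => selfSimilarCollapsePressure (1 / (2 + ρ)) T P τ (x - x₀))
    (hV : ContDiff ℝ 2 V)
    (hS : ∀ P' : EuclideanSpace ℝ (Fin 3) → ℝ, IsSelfSimilarEulerProfile (1 / (2 + ρ)) 0 V P' →
      ∀ h R₀ : ℝ, ∃ R : ℝ, R₀ ≤ R ∧ ∀ y : EuclideanSpace ℝ (Fin 3), ‖y‖ = R →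
        ⟪y, V y⟫ ≤ -(1 / (2 + ρ) * ‖y‖ ^ 2) →
          (curl V y = 0 ∨ selfSimilarBernoulli (1 / (2 + ρ)) 0 V P' y < h)) : V = 0 := by
  -- adapted from `Past.profile_eq_zero_of_piercingIrrotationalC2` (…SelfSimilarPastPiercingSpheres)
  have h2ρ : (0 : ℝ) < 2 + ρ := by linarith
  have hγ : (0 : ℝ) < 1 / (2 + ρ) := one_div_pos.2 h2ρ
  have hγ2 : 1 / (2 + ρ) < 1 / 2 := one_div_lt_one_div_of_lt two_pos (by linarith)
  obtain ⟨P', hprof⟩ := exists_isSelfSimilarEulerProfile hρ hT₁ hTT₁ hsol hu hp hV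
  have hcurl : ∀ x, curl V x = 0 := fun x => Loc.curl_eq_zero_of_piercingBernoulli hprof hγ hγ2 (hS P' hprof) x
  exact profile_eq_zero_of_irrotationalC2 hρ hρh hT₁ hTT₁ hsol hA hu hp hV hcurl

/-- **PAST-EXACT MEMBER WHOSE `C²` PROFILE HAS BERNOULLI PIERCING IS TRIVIAL** (crux hypotheses verbatim, `0 < ρ ≤ ½`, exact self-similarity
about `(T, x₀)` for `τ < T₁`, `T₁ ≤ 0`, `T₁ ≤ T`; `V ∈ C²`; for every classical pressure `P'` of `V`, every level and every bound, a sphere beyond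
the bound whose fast-inflow points are irrotational or Bernoulli-low).  The past twin of `Loc.selfSimilar_ae_eq_zero_of_piercingBernoulliC2_profile`;
binder shape `IsPastSelfSimilar ρ T T₁ x₀ u p V P` + `ContDiff ℝ 2 V` + `HasBernoulliPiercing ρ V` of the lead skeleton v48. [folklore] -/
theorem selfSimilar_ae_eq_zero_of_piercingBernoulliC2_profile_past (hρ : 0 < ρ) (hρh : ρ ≤ 1 / 2) (hT₁ : T₁ ≤ 0)
    (hTT₁ : T₁ ≤ T) (x₀ : EuclideanSpace ℝ (Fin 3))
    (hsw : IsSuitableWeakSolutionOn (slab (EuclideanSpace ℝ (Fin 3)) (Iio 0) isOpen_Iio) 0 0 u p)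
    (hH : HasWeakSpatialGradientOn (slab (EuclideanSpace ℝ (Fin 3)) (Iio 0) isOpen_Iio) u H)
    (hgauge : ∀ a : ℝ, 0 < a →
      ENNReal.ofReal (a ^ (2 * ρ)) * cknA a (0 : ℝ × EuclideanSpace ℝ (Fin 3)) u +
          ENNReal.ofReal (a ^ ρ) * cknE a (0 : ℝ × EuclideanSpace ℝ (Fin 3)) H +
        ENNReal.ofReal (a ^ (2 * ρ)) * cknD a (0 : ℝ × EuclideanSpace ℝ (Fin 3)) p ≤ (c : ℝ≥0∞))
    (hu : ∀ τ : ℝ, τ < T₁ → u τ = fun x => selfSimilarCollapse (1 / (2 + ρ)) T V τ (x - x₀))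
    (hp : ∀ τ : ℝ, τ < T₁ → p τ = fun x => selfSimilarCollapsePressure (1 / (2 + ρ)) T P τ (x - x₀))
    (hV : ContDiff ℝ 2 V)
    (hS : ∀ P' : EuclideanSpace ℝ (Fin 3) → ℝ, IsSelfSimilarEulerProfile (1 / (2 + ρ)) 0 V P' →
      ∀ h R₀ : ℝ, ∃ R : ℝ, R₀ ≤ R ∧ ∀ y : EuclideanSpace ℝ (Fin 3), ‖y‖ = R →
        ⟪y, V y⟫ ≤ -(1 / (2 + ρ) * ‖y‖ ^ 2) →
          (curl V y = 0 ∨ selfSimilarBernoulli (1 / (2 + ρ)) 0 V P' y < h)) :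
    uncurry u =ᵐ[volume.restrict (Iio (0 : ℝ) ×ˢ (univ : Set (EuclideanSpace ℝ (Fin 3))))] 0 :=
  have hA : ∀ a : ℝ, 0 < a → ENNReal.ofReal (a ^ (2 * ρ)) *
      cknA a (0 : ℝ × EuclideanSpace ℝ (Fin 3)) u ≤ (c : ℝ≥0∞) :=
    fun a ha => le_trans (le_trans le_self_add le_self_add) (hgauge a ha)
  ae_eq_zero_of_profile_eq_zero hρ.le hsw hH hgauge hu
    (profile_eq_zero_of_piercingBernoulliC2 hρ hρh hT₁ hTT₁ hsw.distributional hA hu hp hV hS)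

end Summit.NavierStokesRegularity.NavierStokesRegularity.Theorems.PowerGaugeEulerLiouville.Past
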